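import Summits.Ventures.CertifiedArithmetic.LowPrec.SRLaw
import Summits.Ventures.CertifiedArithmetic.LowPrec.SRBiasSign
import Summits.Ventures.CertifiedArithmetic.LowPrec.SRSureNoSat
import HarnessLib

/-!
# Rung R3, exact laws and stochastic monotonicity: the every-format SR statements as venture Props

HONEST FRAMING: certified error envelopes and provably optimal rounding/accumulation schemes for
low-precision formats under stated cost models; every table by two implementations; no hardware or
vendor claims.

Sequel to `SRRungR3Saturation.lean` (generation 4: saturation certified from headroom).  This file
states, over the substrate value set `MiniFloat.valueSet φ` of an ARBITRARY format `φ` (saturating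
SR-nearness, hull `[−maxRat, maxRat]`) and for ARBITRARY summation trees, the generation-5 statements
and inhabits each Prop by a landed theorem (no new mathematics here):

* `R3_SRStochasticMonotone φ` — every SR reduction tree is stochastically monotone in every summand:
  `T ≤ T'` leafwise ⇒ `E f(ŝ_T) ≤ E f(ŝ_T')` for nondecreasing `f`, the upper-saturation probability
  is nondecreasing and the lower-saturation probability nonincreasing (`SRMonotone.lean`);
* `R3_SRBoxCertificate φ` — `Tlo ≤ T ≤ Thi` leafwise ⇒
  `P(sat, T) ≤ P(upper exit, Thi) + P(lower exit, Tlo)`; nonnegative data: `P(sat, T) ≤ P(upper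
  exit, Thi)`; and `P(upper exit, T) ≤ P(sat, T)` (the bound is attained at the corner)
  (`SRBoxCertificate.lean`);
* `R3_SRExactLaw φ` — the forward dynamic programme `lawE` IS the law: for every exit predicate,
  tree and integrand `E ψ(ŝ_T, flag) = Σ_atoms p·ψ(v, b)`, in particular `P(sat)` is the DP value
  (`SRLaw.lean`; polynomial cost, kernel-evaluable);
* `R3_SRBiasSign φ` — saturating SR summation of nonnegative data under-estimates in the mean, of
  nonpositive data over-estimates, in every order (`SRBiasSign.lean`);
* `R3_SRSureCertificate φ` — the `O(m)` interval certificate `HullCert` (file VI) certifies, for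
  every tree, BOTH unbiasedness (`treeBias = 0`, gen1) AND exactly zero saturation probability
  (`satProbT = 0`, `SRSureNoSat.lean`).

Certificates (`certs/sr/gen5/`, two independent implementations, byte-identical laws): the exact
laws of 44 named data vectors (E3M2/E4M3/E5M2, balanced vs sequential; the FP8 rows are named-vector
certificates, not tables); kernel third route for E3M2 16/24/32 ones and E2M1 8 ones.
-/

namespace Summit.Ventures.CertifiedArithmetic

open Literature.ComputerArithmetic.FloatingPoint
open Literature.ComputerArithmetic.FloatingPoint.MiniFloat
open Summit.Ventures.CertifiedArithmetic.LowPrec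

/-- `0` is a value of every format (the code `MiniFloat.zero`). -/
theorem zero_mem_valueSet (φ : Format) : (0 : ℚ) ∈ valueSet φ := by
  have h := toRat_mem_valueSet (MiniFloat.zero φ)
  rwa [toRat_zero] at h

/-- `−maxRat ≤ 0`. -/
theorem neg_maxRat_nonpos (φ : Format) : -φ.maxRat ≤ 0 :=
  ((SR.valueSet_bounds φ).2.2 0 (zero_mem_valueSet φ)).1

/-! ### Stochastic monotonicity -/

/-- R3 (stochastic monotonicity, every format, every tree shape): if `T ≤ T'` leafwise then
(i) `E f(ŝ_T) ≤ E f(ŝ_T')` for every nondecreasing `f`; (ii) `P(some node value > maxRat)` is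
nondecreasing and (iii) `P(some node value < −maxRat)` nonincreasing in the data.
PROVED (sr seat): `LowPrec.SR.treeExp_mono_leaves`, `exitE_mono_leaves`, `exitE_anti_leaves`. -/
def R3_SRStochasticMonotone (φ : Format) : Prop :=
  ∀ T T' : SR.STree ℚ, SR.LeafLE T T' →
    (∀ f : ℚ → ℚ, Monotone f → SR.treeExp (valueSet φ) T f ≤ SR.treeExp (valueSet φ) T' f)
    ∧ SR.exitE (valueSet φ) (fun c => decide (φ.maxRat < c)) T
        ≤ SR.exitE (valueSet φ) (fun c => decide (φ.maxRat < c)) T'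
    ∧ SR.exitE (valueSet φ) (fun c => decide (c < -φ.maxRat)) T'
        ≤ SR.exitE (valueSet φ) (fun c => decide (c < -φ.maxRat)) T

/-- `R3_SRStochasticMonotone`: PROVED for every format. -/
theorem R3_SRStochasticMonotone_holds (φ : Format) : R3_SRStochasticMonotone φ :=
  fun _ _ h => ⟨fun _ hf => SR.treeExp_mono_leaves (valueSet_nonempty φ) h hf,
    SR.exitE_mono_leaves (valueSet_nonempty φ) _ h, SR.exitE_anti_leaves (valueSet_nonempty φ) _ h⟩

/-! ### The box certificate -/

/-- R3 (box certificate, every format, every tree shape): (i) `Tlo ≤ T ≤ Thi` leafwise ⇒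
`P(sat, T) ≤ P(upper exit, Thi) + P(lower exit, Tlo)`; (ii) for nonnegative data (`0 ≤ T ≤ Thi`)
`P(sat, T) ≤ P(upper exit, Thi)`; (iii) `P(upper exit, T) ≤ P(sat, T)` — so (ii) is attained at
`T = Thi`.  PROVED (sr seat): `LowPrec.SR.satProbT_le_corners`, `satProbT_le_upper_corner`,
`exitE_upper_le_satProbT` (SRBoxCertificate.lean). -/
def R3_SRBoxCertificate (φ : Format) : Prop :=
  (∀ Tlo T Thi : SR.STree ℚ, SR.LeafLE Tlo T → SR.LeafLE T Thi →
      SR.satProbT (valueSet φ) T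
        ≤ SR.exitE (valueSet φ) (fun c => decide (φ.maxRat < c)) Thi
          + SR.exitE (valueSet φ) (fun c => decide (c < -φ.maxRat)) Tlo)
  ∧ (∀ T Thi : SR.STree ℚ, SR.LeafLE (T.map fun _ => (0 : ℚ)) T → SR.LeafLE T Thi →
      SR.satProbT (valueSet φ) T ≤ SR.exitE (valueSet φ) (fun c => decide (φ.maxRat < c)) Thi)
  ∧ (∀ T : SR.STree ℚ,
      SR.exitE (valueSet φ) (fun c => decide (φ.maxRat < c)) T ≤ SR.satProbT (valueSet φ) T)

/-- `R3_SRBoxCertificate`: PROVED for every format. -/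
theorem R3_SRBoxCertificate_holds (φ : Format) : R3_SRBoxCertificate φ := by
  obtain ⟨hlo, hhi, hb⟩ := SR.valueSet_bounds φ
  exact ⟨fun _ _ _ h₁ h₂ => SR.satProbT_le_corners hlo hhi hb h₁ h₂,
    fun _ _ h₁ h₂ => SR.satProbT_le_upper_corner hlo hhi hb (zero_mem_valueSet φ)
      (neg_maxRat_nonpos φ) h₁ h₂,
    fun T => SR.exitE_upper_le_satProbT hlo hhi hb T⟩

/-! ### The exact forward law -/

/-- R3 (exact law, every format, every tree, every exit predicate): the forward dynamic programme
`lawE` of `SRLaw.lean` is exact — `E ψ(ŝ_T, flag) = lawSum (lawE F e T) ψ` for every integrand `ψ`;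
in particular `P(sat, T)` is the DP value for the exit predicate `c < −maxRat ∨ maxRat < c`.
PROVED (sr seat): `LowPrec.SR.treeExpE_eq_lawSum`, `satProbT_eq_lawSum` (SRLaw.lean). -/
def R3_SRExactLaw (φ : Format) : Prop :=
  (∀ (e : ℚ → Bool) (T : SR.STree ℚ) (ψ : ℚ → Bool → ℚ),
      SR.treeExpE (valueSet φ) e T ψ = SR.lawSum (SR.lawE (valueSet φ) e T) ψ)
  ∧ ∀ T : SR.STree ℚ, SR.satProbT (valueSet φ) T
      = SR.lawSum (SR.lawE (valueSet φ)
          (fun c => decide (c < -φ.maxRat) || decide (φ.maxRat < c)) T)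
          (fun _ fl => if fl then 1 else 0)

/-- `R3_SRExactLaw`: PROVED for every format. -/
theorem R3_SRExactLaw_holds (φ : Format) : R3_SRExactLaw φ := by
  obtain ⟨hlo, hhi, hb⟩ := SR.valueSet_bounds φ
  exact ⟨fun e T ψ => SR.treeExpE_eq_lawSum _ e T ψ, fun T => SR.satProbT_eq_lawSum hlo hhi hb T⟩

/-! ### The sign of the saturation bias -/

/-- R3 (sign of the bias, every format, every tree): nonnegative data under-estimate in the mean
(`E ŝ_T ≤ Σ_T`, `treeBias ≤ 0`), nonpositive data over-estimate (`Σ_T ≤ E ŝ_T`).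
PROVED (sr seat): `LowPrec.SR.treeMean_le_exact_of_nonneg`, `treeBias_nonpos_of_nonneg`,
`exact_le_treeMean_of_nonpos` (SRBiasSign.lean). -/
def R3_SRBiasSign (φ : Format) : Prop :=
  (∀ T : SR.STree ℚ, SR.LeafLE (T.map fun _ => (0 : ℚ)) T →
      SR.treeExp (valueSet φ) T (fun v => v) ≤ T.exact ∧ SR.treeBias (valueSet φ) T ≤ 0)
  ∧ ∀ T : SR.STree ℚ, SR.LeafLE T (T.map fun _ => (0 : ℚ)) →
      T.exact ≤ SR.treeExp (valueSet φ) T (fun v => v)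

/-- `R3_SRBiasSign`: PROVED for every format. -/
theorem R3_SRBiasSign_holds (φ : Format) : R3_SRBiasSign φ :=
  ⟨fun _ hT => ⟨SR.treeMean_le_exact_of_nonneg (zero_mem_valueSet φ) hT,
      SR.treeBias_nonpos_of_nonneg (zero_mem_valueSet φ) hT⟩,
    fun _ hT => SR.exact_le_treeMean_of_nonpos (zero_mem_valueSet φ) hT⟩

/-! ### Sure certificates -/

/-- R3 (sure certificate, every format, every tree): if the `O(m)` interval certificate holds
(worst-case rounding ranges stay in the hull at every node) then the SR tree sum is unbiased AND
saturates with probability exactly `0`.  PROVED (sr seat): `LowPrec.SR.bias_and_sat_zero_of_hullCert`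
(SRSureNoSat.lean; gen1's `treeBias_eq_zero_of_noSatT` + gen5's `satProbT_eq_zero_of_noSatT`). -/
def R3_SRSureCertificate (φ : Format) : Prop :=
  ∀ T : SR.STree ℚ, SR.HullCert (valueSet φ) T →
    SR.treeBias (valueSet φ) T = 0 ∧ SR.satProbT (valueSet φ) T = 0

/-- `R3_SRSureCertificate`: PROVED for every format. -/
theorem R3_SRSureCertificate_holds (φ : Format) : R3_SRSureCertificate φ :=
  fun T hT => SR.bias_and_sat_zero_of_hullCert (valueSet_nonempty φ) T hT

end Summit.Ventures.CertifiedArithmetic
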